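import Literature.NumberTheory.DiophantineGeometry.AbcWave0GranvilleStarkTheorem1UnramifiedProofs
import Literature.Barriers.ABC.UniformABCImpliesNoSiegelZerosProofs
import HarnessLib

/-!
# Granville–Stark, Theorem 1 (`granville_stark`): its one remaining input — the Hilbert class
# field of an imaginary quadratic field carries `j(τ_D)` with `(j) = 𝔞³`, `(j − 1728) = 𝔟²` — as a
# named fact

Topic `Literature/NumberTheory/DiophantineGeometry`; companion of `AbcWave0.lean` and of the
proofs-only chain `AbcWave0GranvilleStark{Heights,HeightProofs,Theorem1*Proofs,…}.lean`
(A. Granville, H. M. Stark, *ABC implies no "Siegel zeros" for L-functions of characters with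
negative discriminant*, Invent. Math. 139 (2000) 509–523, Theorem 1: uniform `abc` ⟹
`h(−d) ≥ (π/3 + o(1)) √d/log d`). Librarian fact decomposition (`fact-decompose`, human
2026-08-16) of the budget-capped named fact
`Literature.NumberTheory.DiophantineGeometry.granville_stark`.

State of the tree: `granville_stark_of_unramified_cubeSquare`
(`AbcWave0GranvilleStarkTheorem1UnramifiedProofs.lean`) PROVES Theorem 1 from one displayed
hypothesis `H` — everything else of §2 (heights of `j`, `γ₂`, `γ₃`; eq. (1) applied to
`γ₃² − γ₂³ + 1728 = 0`; the Kummer/different bound replacing Lemma 1's conductor–discriminant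
computation; `|d_L| = |d_K|^{[L:K]}` for unramified `L/K`) being proved. This file names `H`:

* `GranvilleStark.exists_unramified_cubeSquare_singularModulus` — for every imaginary quadratic
  `K` with `|d_K|` large there is a number field `L ⊇ K`, unramified over `𝓞_K` at all maximal
  ideals, with a complex embedding `σ`, an algebraic integer `j₀` with `σ(j₀) = j(τ_{d_K})` (the
  singular modulus of the principal form), and ideals `𝔞, 𝔟` of `𝓞_L` with `(j₀) = 𝔞³`,
  `(j₀ − 1728) = 𝔟²`. With `L = K(j(τ_D))` this is the conjunction of two classical theorems of
  complex multiplication absent from Mathlib and the tree: (U) `K(j(τ_D))/K` is unramified — it is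
  the Hilbert class field (Weber–Fueter–Hasse; Cox, *Primes of the form x² + ny²*, Thm. 11.1 with
  §5.C/§8.A); (C) `(j(τ_D))` is the cube and `(j(τ_D) − 1728)` the square of an ideal of the
  Hilbert class field `H`, `D < −4`: for the CM curve `E/H` with `j(E) = j(τ_D)` the inertia group
  at every prime `𝔓` of `H` acts on `E` through `Aut(E) = μ(𝓞_K) = {±1}` (Serre–Tate 1968, CM
  theory; Silverman, *Advanced Topics*, II §5 and V §3–4), so `E` acquires good reduction after a
  quadratic extension, `6 ∣ v_𝔓(Δ_min)`, whence `3 ∣ v_𝔓(j) = v_𝔓(c₄³/Δ)` and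
  `2 ∣ v_𝔓(j − 1728) = v_𝔓(c₆²/Δ)` (cf. `j(τ_{−163}) = −640320³`, `j − 1728 = −163·(2³3³7·11·19·127)²`,
  Gross–Zagier, *On singular moduli* (1985), p. 191; Weber's `γ₂ = ∛j`, `γ₃ = √(j − 1728)`,
  Cox §12.B). The two are bundled because they concern the SAME field `L`, which the tree cannot
  yet name (no ring/Hilbert class field construction in Mathlib);
* `granville_stark_holds_of` — the assembly, `granville_stark_of_unramified_cubeSquare`.

The child does not restate the parent (an algebraic statement about singular moduli in class
fields vs. an analytic class-number lower bound conditional on uniform `abc`).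

## References

* [GranvilleStark2000] §2, Lemma 1 and the proof of Theorem 1 (pp. 512–514).
* [Cox2013] D. A. Cox, *Primes of the form x² + ny²*, 2nd ed.: §5.C, §8.A, Thm. 11.1, §12.B.
* J.-P. Serre, J. Tate, *Good reduction of abelian varieties*, Ann. of Math. 88 (1968) 492–517
  (potential good reduction of CM abelian varieties; the inertia action through `μ`).
* J. H. Silverman, *Advanced Topics in the Arithmetic of Elliptic Curves*, GTM 151, II §5, V §3–4.
* B. Gross, D. Zagier, *On singular moduli*, J. reine angew. Math. 355 (1985) 191–220, p. 191.
-/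

noncomputable section

open NumberField Module

namespace Literature.NumberTheory.DiophantineGeometry

open Literature.NumberTheory.NumberFields Literature.NumberTheory.EllipticCurves
  Literature.NumberTheory.QuadraticFields.BinaryQuadraticForm

namespace GranvilleStark

/-- **The CM input of Granville–Stark's Theorem 1: an everywhere-unramified extension of an
imaginary quadratic field carrying its singular modulus with `(j) = 𝔞³`, `(j − 1728) = 𝔟²`.**
There is `d₁` such that for every number field `K` with `[K:ℚ] = 2` and no real place
(imaginary quadratic) with `|d_K| ≥ d₁` there are a number field `L` with `Algebra K L`,
unramified over `𝓞_K` at every maximal ideal of `𝓞_L` (`Algebra.IsUnramifiedAt (𝓞 K) P`), a ring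
homomorphism `σ : L →+* ℂ`, `j₀ ∈ 𝓞_L` with `σ j₀ = formJ (principalForm d_K)` (the value of the
modular `j`-function at the CM point of the principal form of discriminant `d_K`,
`AbcWave0GranvilleStarkHeights.lean`), and ideals `𝔞 𝔟` with `Ideal.span {j₀} = 𝔞 ^ 3`,
`Ideal.span {j₀ − 1728} = 𝔟 ^ 2`. Sources, with `L = K(j(τ_D))` the Hilbert class field:
Granville–Stark 2000, §2 (proof of Lemma 1: "`γ₂(τ)` and `γ₃(τ)` … generate the ray class field of
conductor `6`"; here only the unramified field `K(j)` and the ideal-theoretic shadow of Weber's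
theorem are needed, thanks to the tree's Kummer/different computation); (U) Cox, *Primes of the
form x² + ny²*, Thm. 11.1 ("`K(j(𝔞))` is the Hilbert class field of `K`") with Thm. 8.10/§8.A (the
Hilbert class field is unramified at all finite primes); (C) for `D < −4` the inertia groups of
`H = K(j(τ_D))` act on the CM curve of invariant `j(τ_D)` through `μ(𝓞_K) = {±1}` (Serre–Tate
1968; Silverman, *Advanced Topics*, II §5, V §3–4), so `6 ∣ v_𝔓(Δ_min)` and `3 ∣ v_𝔓(j)`,
`2 ∣ v_𝔓(j − 1728)` at every prime `𝔓` of `H`, i.e. `(j) = 𝔞³`, `(j − 1728) = 𝔟²` as ideals of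
`𝓞_H` (the ideal-theoretic shadow of Weber's `γ₂ = ∛j`, `γ₃ = √(j−1728)`, Cox §12.B; example
`j(τ_{−163}) = −640320³`, Gross–Zagier 1985, p. 191). This is the hypothesis `H` of the tree's
PROVED `granville_stark_of_unramified_cubeSquare`, verbatim.
[cite: GranvilleStark2000, §2, Lemma 1 and proof of Theorem 1] [cite: Cox2013, Thm. 11.1 (K(j) is the Hilbert class field) and §12.B] -/
def exists_unramified_cubeSquare_singularModulus : Prop :=
  ∃ d₁ : ℝ, ∀ (K : Type) [Field K] [NumberField K],
    Module.finrank ℚ K = 2 → NumberField.InfinitePlace.nrRealPlaces K = 0 →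
    d₁ ≤ |(NumberField.discr K : ℝ)| →
      ∃ (L : Type) (_ : Field L) (_ : NumberField L) (_ : Algebra K L) (σ : L →+* ℂ) (j₀ : 𝓞 L)
        (𝔞 𝔟 : Ideal (𝓞 L)),
        σ j₀ = formJ (principalForm (NumberField.discr K)) ∧
        (∀ (P : Ideal (𝓞 L)) [P.IsMaximal], Algebra.IsUnramifiedAt (𝓞 K) P) ∧
        Ideal.span {j₀} = 𝔞 ^ 3 ∧ Ideal.span {j₀ - 1728} = 𝔟 ^ 2

end GranvilleStark

/-- **Granville–Stark, Theorem 1 (`granville_stark`: uniform `abc` ⟹ `h(−d) ≥ (π/3 − δ)√d/log d`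
for large `d`) from its CM input** — the fact split: the tree's
`granville_stark_of_unramified_cubeSquare` (heights §2, eq. (1), `|d_L| = |d_K|^{[L:K]}`,
Kummer/different bounds — all proved) applied to the child.
[cite: GranvilleStark2000, Theorem 1 and §2] -/
theorem granville_stark_holds_of (H : GranvilleStark.exists_unramified_cubeSquare_singularModulus) :
    granville_stark :=
  granville_stark_of_unramified_cubeSquare H

/-- **The CM input is PROVED**: the discharge of `GranvilleStark.exists_unramified_cubeSquare_singularModulus`
(the Hilbert class field `H_K = K(j(τ_{d_K}))` is unramified over `K`, and `(j(τ_{d_K}))`,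
`(j(τ_{d_K}) − 1728)` are a cube and a square of ideals of `𝓞_{H_K}` — Weber–Fueter–Hasse and the
ideal-theoretic Weber theorem, proved in `Literature/NumberTheory/EllipticCurves/SingularModuli*` and
assembled in `Literature.Barriers.ABC.exists_unramified_cubeSquare_singularModulus_all`).
[cite: Cox2013, Thm. 11.1 and Thm. 12.2] [cite: GranvilleStark2000, §2 Lemma 1] -/
theorem GranvilleStark.exists_unramified_cubeSquare_singularModulus_holds :
    GranvilleStark.exists_unramified_cubeSquare_singularModulus :=
  Literature.Barriers.ABC.exists_unramified_cubeSquare_singularModulus_all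

/-- **Granville–Stark 2000, Theorem 1 (PROVED)**: the discharge of `granville_stark`.
[cite: GranvilleStark2000, Theorem 1] -/
theorem granville_stark_holds : granville_stark :=
  granville_stark_holds_of GranvilleStark.exists_unramified_cubeSquare_singularModulus_holds

/-- **Granville–Stark 2000, Theorem 2 (PROVED)**: the discharge of `granville_stark_noSiegelZeros`
(uniform `abc` ⟹ no Siegel zeros for odd negative fundamental discriminants).
[cite: GranvilleStark2000, Theorem 2] -/
theorem granville_stark_noSiegelZeros_holds : granville_stark_noSiegelZeros :=
  Literature.Barriers.ABC.UniformABCImpliesNoSiegelZeros_holds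

end Literature.NumberTheory.DiophantineGeometry

end
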